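import Mathlib
import Summits.QuantumFields.YangMills.Theorems.ConvexGribovBodyContinuumLegGivenGapStubCsclConv
import Summits.QuantumFields.YangMills.Theorems.ConvexGribovBodyContinuumLegGivenGapCsclTorusForms
import HarnessLib

/-!
# `ContinuumLegGivenGap` (stmt-QuantumFields-15828), line `Sketch`, reshape 18b: `stub_csclKernel` — finite-dimensional uniformity of centred pairings over the weights

Support file for the crux item stmt-QuantumFields-15828 (registered glue stub `stub_csclKernel` of line `Sketch`, reshape 18b).

Along the odd torus sides `2 Sq j + 1` consider the centred pairings
`𝒫°_σ(𝔛_w, 𝔛_{w'}) = ∫ conj 𝔛_w(Θ Ũ) · 𝔛_{w'}(τ^σ Ũ) dμ − conj(∫ 𝔛_w(Ũ) dμ) (∫ 𝔛_{w'}(Ũ) dμ)` of the weighted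
representatives `𝔛_w(V) = ∑ₓ w x ∏ᵢ (P(θ_{xᵢ} V) − m)` on strings of `n` (resp. `m`) points of the box of side `R`
(`P = r.curvature.F`, `Θ = cfgReflect`, `τ^σ = configShift (−σ e₀)`, `Ũ = torusLift (2 Sq j + 1) U`). The index sets
of strings are FINITE, so `𝒫°_σ(𝔛_w, 𝔛_{w'}) = ∑ₓ ∑_y conj(w x) w' y K^j_σ(x, y) − conj(∑ₓ w x e^j(x)) (∑_y w' y e'^j(y))`
with finitely many kernel entries `K^j_σ(x, y)` (pairings of monomials) and means `e^j(x)`, each of which converges as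
`j → ∞` by the raw monomial convergence hypothesis (`csclConv_centred`). Hence for `δ > 0` and `σ ≤ σmax` there is ONE
`j₀`, independent of the weights, beyond which every centred pairing is within `δ (∑ ‖w‖) (∑ ‖w'‖)` of its limit
(the means are bounded by `(C + |m|)^n` on a probability space). The bookkeeping is done in a `G`-blind form:
`csclKernel_seq` (finitely many convergent sequences, sesquilinear error bound), `csclKernel_pairing_expand` /
`csclKernel_mean_expand` (linearity of the integral over finite sums). No definitions, no facts; Mathlib + landed
tree lemmas only. [folklore]
-/

noncomputable section

namespace Summit.QuantumFields.YangMills.Theorems.ContinuumLegGivenGap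

open scoped SchwartzMap ComplexConjugate
open Filter Topology MeasureTheory
open Literature.MathematicalPhysics.QuantumFieldTheory Literature.MathematicalPhysics.QuantumLattice
  Literature.MathematicalPhysics.AQFT Literature.Probability.LatticeModels

/-! ### Finite-dimensional analysis: finitely many convergent sequences -/

/-- Finitely many convergent complex sequences are eventually simultaneously `ε`-close to their limits. [folklore] -/
theorem csclKernel_eventually_close {ι : Type*} [Finite ι] (f : ι → ℕ → ℂ) (L : ι → ℂ)
    (h : ∀ i, Tendsto (f i) atTop (𝓝 (L i))) {ε : ℝ} (hε : 0 < ε) :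
    ∀ᶠ j in atTop, ∀ i, ‖f i j - L i‖ ≤ ε :=
  Filter.eventually_all.2 fun i =>
    ((h i).eventually (Metric.closedBall_mem_nhds (L i) hε)).mono fun j hj => by
      have hj' := Metric.mem_closedBall.1 hj
      rwa [dist_eq_norm] at hj'

/-- A weighted finite sum of vectors of norm `≤ b` has norm `≤ (∑ ‖wₓ‖) b`. [folklore] -/
theorem csclKernel_norm_wsum_le {X : Type*} [Fintype X] (w : X → ℂ) (v : X → ℂ) {b : ℝ}
    (h : ∀ x, ‖v x‖ ≤ b) : ‖∑ x, w x * v x‖ ≤ (∑ x, ‖w x‖) * b := by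
  rw [Finset.sum_mul]
  exact norm_sum_le_of_le _ fun x _ => by
    rw [norm_mul]
    exact mul_le_mul_of_nonneg_left (h x) (norm_nonneg _)

/-- **Uniformity over the weights (abstract form).** Let `K j σ x y`, `e j x`, `e' j y` be complex sequences indexed
by finite sets `X ∋ x`, `Y ∋ y` and `σ : ℕ`, each convergent as `j → ∞`, with `‖e j x‖ ≤ E`, `‖e' j y‖ ≤ E'`. Then for
`δ > 0` and `σmax` there is `j₀` such that for `j ≥ j₀`, all weights `w, w'`, all `σ ≤ σmax` and every limit `l` of
the sesquilinear expression `∑ₓ∑_y conj(w x) w' y K j σ x y − conj(∑ₓ w x e j x)(∑_y w' y e' j y)`, its value at `j`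
is within `δ (∑ ‖w x‖) (∑ ‖w' y‖)` of `l`. [folklore] -/
theorem csclKernel_seq {X Y : Type*} [Fintype X] [Fintype Y] (K : ℕ → ℕ → X → Y → ℂ)
    (e : ℕ → X → ℂ) (e' : ℕ → Y → ℂ) {E E' : ℝ} (hE0 : 0 ≤ E) (hE0' : 0 ≤ E')
    (hE : ∀ j x, ‖e j x‖ ≤ E) (hE' : ∀ j y, ‖e' j y‖ ≤ E')
    (hK : ∀ σ x y, ∃ l : ℂ, Tendsto (fun j => K j σ x y) atTop (𝓝 l))
    (he : ∀ x, ∃ l : ℂ, Tendsto (fun j => e j x) atTop (𝓝 l))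
    (he' : ∀ y, ∃ l : ℂ, Tendsto (fun j => e' j y) atTop (𝓝 l))
    {δ : ℝ} (hδ : 0 < δ) (σmax : ℕ) :
    ∃ j₀ : ℕ, ∀ j : ℕ, j₀ ≤ j → ∀ (w : X → ℂ) (w' : Y → ℂ) (σ : ℕ) (l : ℂ), σ ≤ σmax →
      Tendsto (fun j => (∑ x, ∑ y, (starRingEnd ℂ) (w x) * w' y * K j σ x y) -
        (starRingEnd ℂ) (∑ x, w x * e j x) * (∑ y, w' y * e' j y)) atTop (𝓝 l) →
      ‖((∑ x, ∑ y, (starRingEnd ℂ) (w x) * w' y * K j σ x y) -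
        (starRingEnd ℂ) (∑ x, w x * e j x) * (∑ y, w' y * e' j y)) - l‖ ≤
        δ * (∑ x, ‖w x‖) * (∑ y, ‖w' y‖) := by
  choose Kl hKl using hK
  choose el hel using he
  choose el' hel' using he'
  have hEl : ∀ x, ‖el x‖ ≤ E := fun x => le_of_tendsto' (hel x).norm fun j => hE j x
  have hpos : 0 < 1 + E' + E := by linarith
  obtain ⟨δ', hδ'0, hδ'⟩ : ∃ δ' : ℝ, 0 < δ' ∧ δ' * (1 + E' + E) = δ :=
    ⟨δ / (1 + E' + E), div_pos hδ hpos, div_mul_cancel₀ δ hpos.ne'⟩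
  have h1 := csclKernel_eventually_close
    (fun (p : Fin (σmax + 1) × X × Y) j => K j (p.1 : ℕ) p.2.1 p.2.2) (fun p => Kl (p.1 : ℕ) p.2.1 p.2.2)
    (fun p => hKl _ _ _) hδ'0
  have h2 := csclKernel_eventually_close (fun x j => e j x) el hel hδ'0
  have h3 := csclKernel_eventually_close (fun y j => e' j y) el' hel' hδ'0
  obtain ⟨j₀, hj₀⟩ := eventually_atTop.1 ((h1.and h2).and h3)
  refine ⟨j₀, fun j hj w w' σ l hσ hT => ?_⟩
  obtain ⟨⟨hKj, hej⟩, he'j⟩ := hj₀ j hj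
  have hKj' : ∀ x y, ‖K j σ x y - Kl σ x y‖ ≤ δ' := fun x y => hKj (⟨σ, Nat.lt_succ_of_le hσ⟩, x, y)
  -- the limit of the sesquilinear expression
  have hlim : Tendsto (fun j => (∑ x, ∑ y, (starRingEnd ℂ) (w x) * w' y * K j σ x y) -
      (starRingEnd ℂ) (∑ x, w x * e j x) * (∑ y, w' y * e' j y)) atTop
      (𝓝 ((∑ x, ∑ y, (starRingEnd ℂ) (w x) * w' y * Kl σ x y) -
        (starRingEnd ℂ) (∑ x, w x * el x) * (∑ y, w' y * el' y))) :=
    (tendsto_finsetSum _ fun x _ => tendsto_finsetSum _ fun y _ => (hKl σ x y).const_mul _).sub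
      (((Complex.continuous_conj.tendsto _).comp (tendsto_finsetSum _ fun x _ => (hel x).const_mul _)).mul
        (tendsto_finsetSum _ fun y _ => (hel' y).const_mul _))
  have hl := tendsto_nhds_unique hT hlim
  subst hl
  have hdiff : ((∑ x, ∑ y, (starRingEnd ℂ) (w x) * w' y * K j σ x y) -
        (starRingEnd ℂ) (∑ x, w x * e j x) * (∑ y, w' y * e' j y)) -
      ((∑ x, ∑ y, (starRingEnd ℂ) (w x) * w' y * Kl σ x y) -
        (starRingEnd ℂ) (∑ x, w x * el x) * (∑ y, w' y * el' y)) =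
      (∑ x, ∑ y, (starRingEnd ℂ) (w x) * w' y * (K j σ x y - Kl σ x y)) -
        ((starRingEnd ℂ) (∑ x, w x * (e j x - el x)) * (∑ y, w' y * e' j y) +
          (starRingEnd ℂ) (∑ x, w x * el x) * (∑ y, w' y * (e' j y - el' y))) := by
    simp only [mul_sub, Finset.sum_sub_distrib, map_sub]
    ring
  rw [hdiff]
  have hS : 0 ≤ ∑ x, ‖w x‖ := Finset.sum_nonneg fun _ _ => norm_nonneg _
  have hS' : 0 ≤ ∑ y, ‖w' y‖ := Finset.sum_nonneg fun _ _ => norm_nonneg _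
  -- termwise bounds
  have hb1 : ‖∑ x, ∑ y, (starRingEnd ℂ) (w x) * w' y * (K j σ x y - Kl σ x y)‖ ≤
      (∑ x, ‖w x‖) * (∑ y, ‖w' y‖) * δ' := by
    rw [Finset.sum_mul_sum, Finset.sum_mul]
    refine norm_sum_le_of_le _ fun x _ => ?_
    rw [Finset.sum_mul]
    refine norm_sum_le_of_le _ fun y _ => ?_
    rw [norm_mul, norm_mul, Complex.norm_conj]
    exact mul_le_mul_of_nonneg_left (hKj' x y) (mul_nonneg (norm_nonneg _) (norm_nonneg _))
  have hb2 : ‖(starRingEnd ℂ) (∑ x, w x * (e j x - el x)) * (∑ y, w' y * e' j y)‖ ≤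
      ((∑ x, ‖w x‖) * δ') * ((∑ y, ‖w' y‖) * E') := by
    rw [norm_mul, Complex.norm_conj]
    exact mul_le_mul (csclKernel_norm_wsum_le w _ hej) (csclKernel_norm_wsum_le w' _ (hE' j))
      (norm_nonneg _) (mul_nonneg hS hδ'0.le)
  have hb3 : ‖(starRingEnd ℂ) (∑ x, w x * el x) * (∑ y, w' y * (e' j y - el' y))‖ ≤
      ((∑ x, ‖w x‖) * E) * ((∑ y, ‖w' y‖) * δ') := by
    rw [norm_mul, Complex.norm_conj]
    exact mul_le_mul (csclKernel_norm_wsum_le w _ hEl) (csclKernel_norm_wsum_le w' _ he'j)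
      (norm_nonneg _) (mul_nonneg hS hE0)
  refine (norm_sub_le _ _).trans
    ((add_le_add hb1 ((norm_add_le _ _).trans (add_le_add hb2 hb3))).trans_eq ?_)
  rw [← hδ']
  ring

/-! ### Linearity of the integral over the finite index sets -/

/-- **Kernel expansion of the pairing** of two weighted finite combinations whose left factors are self-conjugate:
`∫ conj(∑ₓ w x A_x) (∑_y w' y B_y) dμ = ∑ₓ ∑_y conj(w x) w' y ∫ A_x B_y dμ`. [folklore] -/
theorem csclKernel_pairing_expand {Ω : Type*} [MeasurableSpace Ω] (μ : Measure Ω) {X Y : Type*} [Fintype X]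
    [Fintype Y] (MA : X → Ω → ℂ) (MB : Y → Ω → ℂ) (hA : ∀ x ω, (starRingEnd ℂ) (MA x ω) = MA x ω)
    (hI : ∀ x y, Integrable (fun ω => MA x ω * MB y ω) μ) (w : X → ℂ) (w' : Y → ℂ) :
    ∫ ω, (starRingEnd ℂ) (∑ x, w x * MA x ω) * (∑ y, w' y * MB y ω) ∂μ =
      ∑ x, ∑ y, (starRingEnd ℂ) (w x) * w' y * ∫ ω, MA x ω * MB y ω ∂μ := by
  have hpt : ∀ ω, (starRingEnd ℂ) (∑ x, w x * MA x ω) * (∑ y, w' y * MB y ω) =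
      ∑ x, ∑ y, (starRingEnd ℂ) (w x) * w' y * (MA x ω * MB y ω) := fun ω => by
    simp only [map_sum, map_mul, hA]
    rw [Finset.sum_mul_sum]
    exact Finset.sum_congr rfl fun x _ => Finset.sum_congr rfl fun y _ => by ring
  simp_rw [hpt]
  rw [integral_finsetSum _ fun x _ => integrable_finsetSum _ fun y _ => (hI x y).const_mul _]
  refine Finset.sum_congr rfl fun x _ => ?_
  rw [integral_finsetSum _ fun y _ => (hI x y).const_mul _]
  exact Finset.sum_congr rfl fun y _ => integral_const_mul _ _

/-- **Expansion of the mean** of a weighted finite combination: `∫ ∑ₓ w x A_x dμ = ∑ₓ w x ∫ A_x dμ`. [folklore] -/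
theorem csclKernel_mean_expand {Ω : Type*} [MeasurableSpace Ω] (μ : Measure Ω) {X : Type*} [Fintype X]
    (M0 : X → Ω → ℂ) (hI : ∀ x, Integrable (M0 x) μ) (w : X → ℂ) :
    ∫ ω, ∑ x, w x * M0 x ω ∂μ = ∑ x, w x * ∫ ω, M0 x ω ∂μ := by
  rw [integral_finsetSum _ fun x _ => (hI x).const_mul _]
  exact Finset.sum_congr rfl fun x _ => integral_const_mul _ _

/-- A centred monomial of `n` factors bounded by `C` has norm `≤ (C + |m|)^n`. [folklore] -/
theorem csclKernel_norm_prod_le {n : ℕ} (a : Fin n → ℝ) (mc : ℝ) {C : ℝ} (h : ∀ i, |a i| ≤ C) :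
    ‖∏ i, ((a i - mc : ℝ) : ℂ)‖ ≤ (C + |mc|) ^ n := by
  rw [norm_prod]
  calc ∏ i, ‖((a i - mc : ℝ) : ℂ)‖ ≤ ∏ _i : Fin n, (C + |mc|) :=
        Finset.prod_le_prod (fun _ _ => norm_nonneg _) fun i _ => by
          rw [Complex.norm_real, Real.norm_eq_abs]
          exact (abs_sub _ _).trans (add_le_add (h i) le_rfl)
    _ = (C + |mc|) ^ n := by rw [Finset.prod_const, Finset.card_univ, Fintype.card_fin]

/-- A centred monomial is self-conjugate. [folklore] -/
theorem csclKernel_conj_prod {ι : Type*} [Fintype ι] (a : ι → ℝ) (mc : ℝ) :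
    (starRingEnd ℂ) (∏ i, ((a i - mc : ℝ) : ℂ)) = ∏ i, ((a i - mc : ℝ) : ℂ) := by
  simp only [map_prod, Complex.conj_ofReal]

/-! ### The registered stub -/

/-- `stub_csclKernel` — **finite-dimensional uniformity of the centred pairings over the weights.** If along the odd
torus sides `2 Sq j + 1` every raw monomial pairing `∫ (∏ᵢ P(θ_{uᵢ} Θ Ũ)) (∏ᵢ P(θ_{vᵢ} τ^σ Ũ)) dμ` converges
(`P = r.curvature.F`, `Θ = cfgReflect`, `τ^σ = configShift (−σ e₀)`), then for `δ > 0` and `σmax` there is `j₀`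
(depending only on `δ, σmax, R, n, m, m_c` and the data, NOT on the weights) such that for `j ≥ j₀`, all weights
`w, w'` on `n`- resp. `m`-strings of the box of side `R`, all `σ ≤ σmax`, the centred pairing
`∫ conj 𝔛_w(Θ Ũ) 𝔛_{w'}(τ^σ Ũ) dμ − conj(∫ 𝔛_w(Ũ) dμ)(∫ 𝔛_{w'}(Ũ) dμ)` is within `δ (∑ ‖w‖)(∑ ‖w'‖)` of its limit:
expand sesquilinearly over the finite index sets (`csclKernel_pairing_expand`, `csclKernel_mean_expand`), each kernel
entry and mean converges (`csclConv_centred`), finitely many sequences are uniformly eventually close to their limits,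
and the means are bounded by `(C + |m_c|)^n` (`csclKernel_seq`). [folklore] -/
theorem stub_csclKernel :
    ∀ (G : Type) [Group G] [TopologicalSpace G] [IsTopologicalGroup G] [CompactSpace G]
      [MeasurableSpace G] [BorelSpace G] (r : LatticeRep G) (β mc : ℝ) (n m R : ℕ) (Sq : ℕ → ℕ),
      (∀ (p q : ℕ) (u : Fin p → Site 4) (v : Fin q → Site 4) (σ : ℕ), ∃ l : ℝ,
        Tendsto (fun j : ℕ => ∫ U : GaugeConfig 4 (2 * Sq j + 1) G,
          (∏ i : Fin p, r.curvature.F (configShift (-(u i)) (cfgReflect (torusLift (2 * Sq j + 1) U)))) *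
            (∏ i : Fin q, r.curvature.F (configShift (-(v i)) (configShift (-(Pi.single 0 ((σ : ℕ) : ℤ))) (torusLift (2 * Sq j + 1) U))))
          ∂(wilsonMeasure r.ρ β)) atTop (𝓝 l)) →
      ∀ (δ : ℝ) (σmax : ℕ), 0 < δ → ∃ j₀ : ℕ, ∀ j : ℕ, j₀ ≤ j →
        ∀ (w : (Fin n → ↥(box 4 R)) → ℂ) (w' : (Fin m → ↥(box 4 R)) → ℂ) (σ : ℕ) (l : ℂ), σ ≤ σmax →
          Tendsto (fun j : ℕ => ((∫ U : GaugeConfig 4 (2 * Sq j + 1) G, (starRingEnd ℂ) ((fun V => ∑ x : Fin n → ↥(box 4 R), w x * ∏ i, ((r.curvature.F (configShift (-↑(x i)) V) - mc : ℝ) : ℂ)) (cfgReflect (torusLift (2 * Sq j + 1) U))) * (fun V => ∑ x : Fin m → ↥(box 4 R), w' x * ∏ i, ((r.curvature.F (configShift (-↑(x i)) V) - mc : ℝ) : ℂ)) (configShift (-(Pi.single 0 ((σ : ℕ) : ℤ))) (torusLift (2 * Sq j + 1) U)) ∂(wilsonMeasure r.ρ β)) - (starRingEnd ℂ) (∫ U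 : GaugeConfig 4 (2 * Sq j + 1) G, (fun V => ∑ x : Fin n → ↥(box 4 R), w x * ∏ i, ((r.curvature.F (configShift (-↑(x i)) V) - mc : ℝ) : ℂ)) (torusLift (2 * Sq j + 1) U) ∂(wilsonMeasure r.ρ β)) * (∫ U : GaugeConfig 4 (2 * Sq j + 1) G, (fun V => ∑ x : Fin m → ↥(box 4 R), w' x * ∏ i, ((r.curvature.F (configShift (-↑(x i)) V) - mc : ℝ) : ℂ)) (torusLift (2 * Sq j + 1) U) ∂(wilsonMeasure r.ρ β)))) atTop (𝓝 l) →
          ‖((∫ U : GaugeConfig 4 (2 * Sq j + 1) G, (starRingEnd ℂ) ((fun V => ∑ x : Fin n → ↥(box 4 R), w x * ∏ i, ((r.curvature.F (configShift (-↑(x i)) V) - mc : ℝ) : ℂ)) (cfgReflect (torusLift (2 * Sq j + 1) U))) * (fun V => ∑ x : Fin m → ↥(box 4 R), w' x * ∏ i, ((r.curvature.F (configShift (-↑(x i)) V) - mc : ℝ) : ℂ)) (configShift (-(Pi.single 0 ((σ : ℕ) : ℤ))) (torusLift (2 * Sq j + 1) U)) ∂(wilsonMeasure r.ρ β)) - (starRingEnd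 ℂ) (∫ U : GaugeConfig 4 (2 * Sq j + 1) G, (fun V => ∑ x : Fin n → ↥(box 4 R), w x * ∏ i, ((r.curvature.F (configShift (-↑(x i)) V) - mc : ℝ) : ℂ)) (torusLift (2 * Sq j + 1) U) ∂(wilsonMeasure r.ρ β)) * (∫ U : GaugeConfig 4 (2 * Sq j + 1) G, (fun V => ∑ x : Fin m → ↥(box 4 R), w' x * ∏ i, ((r.curvature.F (configShift (-↑(x i)) V) - mc : ℝ) : ℂ)) (torusLift (2 * Sq j + 1) U) ∂(wilsonMeasure r.ρ β))) - l‖ ≤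
            δ * (∑ x : Fin n → ↥(box 4 R), ‖w x‖) * (∑ y : Fin m → ↥(box 4 R), ‖w' y‖) := by
  intro G _ _ _ _ _ _ r β mc n m R Sq H δ σmax hδ
  obtain ⟨C, hC⟩ := r.curvature.bounded
  have hC0 : 0 ≤ C := (abs_nonneg _).trans (hC fun _ => 1)
  have hM0 : 0 ≤ C + |mc| := add_nonneg hC0 (abs_nonneg _)
  have hμ : ∀ j : ℕ, IsFiniteMeasure (wilsonMeasure (d := 4) (L := 2 * Sq j + 1) r.ρ β) := fun j => by
    haveI := isProbabilityMeasure_wilsonMeasure (d := 4) (L := 2 * Sq j + 1) r.ρ r.continuous β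
    infer_instance
  -- measurability of the three kinds of shifted factors read on the lift
  have hmA : ∀ (s : Site 4) (j : ℕ), Measurable fun U : GaugeConfig 4 (2 * Sq j + 1) G =>
      r.curvature.F (Literature.MathematicalPhysics.QuantumLattice.configShift (-s) (cfgReflect (torusLift (2 * Sq j + 1) U))) := fun s j =>
    r.curvature.measurable.comp
      ((Literature.MathematicalPhysics.QuantumLattice.configShift _).measurable.comp (measurable_cfgReflect.comp (measurable_torusLift _)))
  have hmB : ∀ (σ : ℕ) (s : Site 4) (j : ℕ), Measurable fun U : GaugeConfig 4 (2 * Sq j + 1) G =>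
      r.curvature.F (Literature.MathematicalPhysics.QuantumLattice.configShift (-s) (Literature.MathematicalPhysics.QuantumLattice.configShift (-(Pi.single 0 ((σ : ℕ) : ℤ))) (torusLift (2 * Sq j + 1) U))) :=
    fun σ s j => r.curvature.measurable.comp
      ((Literature.MathematicalPhysics.QuantumLattice.configShift _).measurable.comp ((Literature.MathematicalPhysics.QuantumLattice.configShift _).measurable.comp (measurable_torusLift _)))
  have hm0 : ∀ (s : Site 4) (j : ℕ), Measurable fun U : GaugeConfig 4 (2 * Sq j + 1) G =>
      r.curvature.F (Literature.MathematicalPhysics.QuantumLattice.configShift (-s) (torusLift (2 * Sq j + 1) U)) := fun s j =>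
    r.curvature.measurable.comp ((Literature.MathematicalPhysics.QuantumLattice.configShift _).measurable.comp (measurable_torusLift _))
  -- kernel entries: integrable at every `j`, convergent as `j → ∞`
  have hK : ∀ (σ : ℕ) (x : Fin n → ↥(box 4 R)) (y : Fin m → ↥(box 4 R)),
      (∀ j : ℕ, Integrable (fun U : GaugeConfig 4 (2 * Sq j + 1) G =>
        (∏ i, ((r.curvature.F (Literature.MathematicalPhysics.QuantumLattice.configShift (-(↑(x i) : Site 4)) (cfgReflect (torusLift (2 * Sq j + 1) U))) - mc : ℝ) : ℂ)) *
          ∏ i, ((r.curvature.F (Literature.MathematicalPhysics.QuantumLattice.configShift (-(↑(y i) : Site 4)) (Literature.MathematicalPhysics.QuantumLattice.configShift (-(Pi.single 0 ((σ : ℕ) : ℤ))) (torusLift (2 * Sq j + 1) U))) - mc : ℝ) : ℂ))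
        (wilsonMeasure (d := 4) (L := 2 * Sq j + 1) r.ρ β)) ∧
      ∃ l : ℂ, Tendsto (fun j : ℕ => ∫ U : GaugeConfig 4 (2 * Sq j + 1) G,
        (∏ i, ((r.curvature.F (Literature.MathematicalPhysics.QuantumLattice.configShift (-(↑(x i) : Site 4)) (cfgReflect (torusLift (2 * Sq j + 1) U))) - mc : ℝ) : ℂ)) *
          ∏ i, ((r.curvature.F (Literature.MathematicalPhysics.QuantumLattice.configShift (-(↑(y i) : Site 4)) (Literature.MathematicalPhysics.QuantumLattice.configShift (-(Pi.single 0 ((σ : ℕ) : ℤ))) (torusLift (2 * Sq j + 1) U))) - mc : ℝ) : ℂ)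
        ∂(wilsonMeasure (d := 4) (L := 2 * Sq j + 1) r.ρ β)) atTop (𝓝 l) := fun σ x y =>
    csclConv_centred (Ω := fun j => GaugeConfig 4 (2 * Sq j + 1) G)
      (fun j => wilsonMeasure (d := 4) (L := 2 * Sq j + 1) r.ρ β) hμ
      (fun (s : Site 4) j U => r.curvature.F (Literature.MathematicalPhysics.QuantumLattice.configShift (-s) (cfgReflect (torusLift (2 * Sq j + 1) U))))
      (fun (s : Site 4) j U => r.curvature.F
        (Literature.MathematicalPhysics.QuantumLattice.configShift (-s) (Literature.MathematicalPhysics.QuantumLattice.configShift (-(Pi.single 0 ((σ : ℕ) : ℤ))) (torusLift (2 * Sq j + 1) U))))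
      hC0 hmA (hmB σ) (fun _ _ _ => hC _) (fun _ _ _ => hC _) (fun p q u v => H p q u v σ)
      (fun i => (↑(x i) : Site 4)) (fun i => (↑(y i) : Site 4)) mc
  -- means: the empty `Θ`-string and `σ = 0` (`configShift (-(0 • e₀)) = id`)
  have h0 : ∀ W : LGConfig 4 G, Literature.MathematicalPhysics.QuantumLattice.configShift (-(Pi.single 0 ((0 : ℕ) : ℤ)) : Site 4) W = W := fun W => by
    funext e
    simp [Literature.MathematicalPhysics.QuantumLattice.configShift_apply]
  have H0 : ∀ (p q : ℕ) (u : Fin p → Site 4) (v : Fin q → Site 4), ∃ l : ℝ,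
      Tendsto (fun j : ℕ => ∫ U : GaugeConfig 4 (2 * Sq j + 1) G,
        (∏ i : Fin p, r.curvature.F (Literature.MathematicalPhysics.QuantumLattice.configShift (-(u i)) (cfgReflect (torusLift (2 * Sq j + 1) U)))) *
          (∏ i : Fin q, r.curvature.F (Literature.MathematicalPhysics.QuantumLattice.configShift (-(v i)) (torusLift (2 * Sq j + 1) U)))
        ∂(wilsonMeasure r.ρ β)) atTop (𝓝 l) := fun p q u v => by
    simpa only [h0] using H p q u v 0
  have hE : ∀ {k : ℕ} (x : Fin k → ↥(box 4 R)),
      (∀ j : ℕ, Integrable (fun U : GaugeConfig 4 (2 * Sq j + 1) G =>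
        ∏ i, ((r.curvature.F (Literature.MathematicalPhysics.QuantumLattice.configShift (-(↑(x i) : Site 4)) (torusLift (2 * Sq j + 1) U)) - mc : ℝ) : ℂ))
        (wilsonMeasure (d := 4) (L := 2 * Sq j + 1) r.ρ β)) ∧
      ∃ l : ℂ, Tendsto (fun j : ℕ => ∫ U : GaugeConfig 4 (2 * Sq j + 1) G,
        ∏ i, ((r.curvature.F (Literature.MathematicalPhysics.QuantumLattice.configShift (-(↑(x i) : Site 4)) (torusLift (2 * Sq j + 1) U)) - mc : ℝ) : ℂ)
        ∂(wilsonMeasure (d := 4) (L := 2 * Sq j + 1) r.ρ β)) atTop (𝓝 l) := fun {k} x => by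
    have hD := csclConv_centred (Ω := fun j => GaugeConfig 4 (2 * Sq j + 1) G)
      (fun j => wilsonMeasure (d := 4) (L := 2 * Sq j + 1) r.ρ β) hμ
      (fun (s : Site 4) j U => r.curvature.F (Literature.MathematicalPhysics.QuantumLattice.configShift (-s) (cfgReflect (torusLift (2 * Sq j + 1) U))))
      (fun (s : Site 4) j U => r.curvature.F (Literature.MathematicalPhysics.QuantumLattice.configShift (-s) (torusLift (2 * Sq j + 1) U)))
      hC0 hmA hm0 (fun _ _ _ => hC _) (fun _ _ _ => hC _) H0
      (fun i : Fin 0 => (Fin.elim0 i : Site 4)) (fun i => (↑(x i) : Site 4)) mc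
    simpa only [Finset.univ_eq_empty, Finset.prod_empty, one_mul] using hD
  -- the means are bounded by `(C + |mc|)^k` (probability space)
  have hEb : ∀ {k : ℕ} (j : ℕ) (x : Fin k → ↥(box 4 R)),
      ‖∫ U : GaugeConfig 4 (2 * Sq j + 1) G,
        ∏ i, ((r.curvature.F (Literature.MathematicalPhysics.QuantumLattice.configShift (-(↑(x i) : Site 4)) (torusLift (2 * Sq j + 1) U)) - mc : ℝ) : ℂ)
        ∂(wilsonMeasure (d := 4) (L := 2 * Sq j + 1) r.ρ β)‖ ≤ (C + |mc|) ^ k := fun {k} j x => by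
    haveI := isProbabilityMeasure_wilsonMeasure (d := 4) (L := 2 * Sq j + 1) r.ρ r.continuous β
    refine (norm_integral_le_of_norm_le_const (Eventually.of_forall fun U => ?_)).trans_eq
      (by rw [probReal_univ, mul_one])
    exact csclKernel_norm_prod_le _ mc fun i => hC _
  -- the abstract uniformity statement for the kernel entries and means
  obtain ⟨j₀, hj₀⟩ := csclKernel_seq (X := Fin n → ↥(box 4 R)) (Y := Fin m → ↥(box 4 R))
    (fun j σ x y => ∫ U : GaugeConfig 4 (2 * Sq j + 1) G,
      (∏ i, ((r.curvature.F (Literature.MathematicalPhysics.QuantumLattice.configShift (-(↑(x i) : Site 4)) (cfgReflect (torusLift (2 * Sq j + 1) U))) - mc : ℝ) : ℂ)) *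
        ∏ i, ((r.curvature.F (Literature.MathematicalPhysics.QuantumLattice.configShift (-(↑(y i) : Site 4)) (Literature.MathematicalPhysics.QuantumLattice.configShift (-(Pi.single 0 ((σ : ℕ) : ℤ))) (torusLift (2 * Sq j + 1) U))) - mc : ℝ) : ℂ)
      ∂(wilsonMeasure (d := 4) (L := 2 * Sq j + 1) r.ρ β))
    (fun j x => ∫ U : GaugeConfig 4 (2 * Sq j + 1) G,
      ∏ i, ((r.curvature.F (Literature.MathematicalPhysics.QuantumLattice.configShift (-(↑(x i) : Site 4)) (torusLift (2 * Sq j + 1) U)) - mc : ℝ) : ℂ)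
      ∂(wilsonMeasure (d := 4) (L := 2 * Sq j + 1) r.ρ β))
    (fun j y => ∫ U : GaugeConfig 4 (2 * Sq j + 1) G,
      ∏ i, ((r.curvature.F (Literature.MathematicalPhysics.QuantumLattice.configShift (-(↑(y i) : Site 4)) (torusLift (2 * Sq j + 1) U)) - mc : ℝ) : ℂ)
      ∂(wilsonMeasure (d := 4) (L := 2 * Sq j + 1) r.ρ β))
    (pow_nonneg hM0 n) (pow_nonneg hM0 m) (fun j x => hEb j x) (fun j y => hEb j y)
    (fun σ x y => (hK σ x y).2) (fun x => (hE x).2) (fun y => (hE y).2) hδ σmax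
  refine ⟨j₀, fun j hj w w' σ l hσ hT => ?_⟩
  -- the centred pairing in kernel form, at every torus
  have key : ∀ j : ℕ,
      ((∫ U : GaugeConfig 4 (2 * Sq j + 1) G, (starRingEnd ℂ) ((fun V => ∑ x : Fin n → ↥(box 4 R), w x * ∏ i, ((r.curvature.F (configShift (-↑(x i)) V) - mc : ℝ) : ℂ)) (cfgReflect (torusLift (2 * Sq j + 1) U))) * (fun V => ∑ x : Fin m → ↥(box 4 R), w' x * ∏ i, ((r.curvature.F (configShift (-↑(x i)) V) - mc : ℝ) : ℂ)) (configShift (-(Pi.single 0 ((σ : ℕ) : ℤ))) (torusLift (2 * Sq j + 1) U)) ∂(wilsonMeasure r.ρ β)) - (starRingEnd ℂ) (∫ U : GaugeConfig 4 (2 * Sq j + 1) G, (fun V => ∑ x : Fin n → ↥(box 4 R), w x * ∏ i, ((r.curvature.F (configShift (-↑(x i)) V) - mc : ℝ) : ℂ)) (torusLift (2 * Sq j + 1) U) ∂(wilsonMeasure r.ρ β)) * (∫ U : GaugeConfig 4 (2 * Sq j + 1) G, (fun V => ∑ x : Fin m → ↥(box 4 R), w' x * ∏ i, ((r.curvature.F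 (configShift (-↑(x i)) V) - mc : ℝ) : ℂ)) (torusLift (2 * Sq j + 1) U) ∂(wilsonMeasure r.ρ β))) =
      (∑ x : Fin n → ↥(box 4 R), ∑ y : Fin m → ↥(box 4 R), (starRingEnd ℂ) (w x) * w' y *
          ∫ U : GaugeConfig 4 (2 * Sq j + 1) G,
            (∏ i, ((r.curvature.F (Literature.MathematicalPhysics.QuantumLattice.configShift (-(↑(x i) : Site 4)) (cfgReflect (torusLift (2 * Sq j + 1) U))) - mc : ℝ) : ℂ)) *
              ∏ i, ((r.curvature.F (Literature.MathematicalPhysics.QuantumLattice.configShift (-(↑(y i) : Site 4)) (Literature.MathematicalPhysics.QuantumLattice.configShift (-(Pi.single 0 ((σ : ℕ) : ℤ))) (torusLift (2 * Sq j + 1) U))) - mc : ℝ) : ℂ)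
            ∂(wilsonMeasure (d := 4) (L := 2 * Sq j + 1) r.ρ β)) -
        (starRingEnd ℂ) (∑ x : Fin n → ↥(box 4 R), w x * ∫ U : GaugeConfig 4 (2 * Sq j + 1) G,
            ∏ i, ((r.curvature.F (Literature.MathematicalPhysics.QuantumLattice.configShift (-(↑(x i) : Site 4)) (torusLift (2 * Sq j + 1) U)) - mc : ℝ) : ℂ)
            ∂(wilsonMeasure (d := 4) (L := 2 * Sq j + 1) r.ρ β)) *
          (∑ y : Fin m → ↥(box 4 R), w' y * ∫ U : GaugeConfig 4 (2 * Sq j + 1) G,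
            ∏ i, ((r.curvature.F (Literature.MathematicalPhysics.QuantumLattice.configShift (-(↑(y i) : Site 4)) (torusLift (2 * Sq j + 1) U)) - mc : ℝ) : ℂ)
            ∂(wilsonMeasure (d := 4) (L := 2 * Sq j + 1) r.ρ β)) := fun j => by
    have h1 := csclKernel_pairing_expand (wilsonMeasure (d := 4) (L := 2 * Sq j + 1) r.ρ β)
      (fun (x : Fin n → ↥(box 4 R)) (U : GaugeConfig 4 (2 * Sq j + 1) G) =>
        ∏ i, ((r.curvature.F (Literature.MathematicalPhysics.QuantumLattice.configShift (-(↑(x i) : Site 4)) (cfgReflect (torusLift (2 * Sq j + 1) U))) - mc : ℝ) : ℂ))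
      (fun (y : Fin m → ↥(box 4 R)) (U : GaugeConfig 4 (2 * Sq j + 1) G) =>
        ∏ i, ((r.curvature.F (Literature.MathematicalPhysics.QuantumLattice.configShift (-(↑(y i) : Site 4)) (Literature.MathematicalPhysics.QuantumLattice.configShift (-(Pi.single 0 ((σ : ℕ) : ℤ))) (torusLift (2 * Sq j + 1) U))) - mc : ℝ) : ℂ))
      (fun x U => csclKernel_conj_prod _ mc) (fun x y => (hK σ x y).1 j) w w'
    have h2 := csclKernel_mean_expand (wilsonMeasure (d := 4) (L := 2 * Sq j + 1) r.ρ β)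
      (fun (x : Fin n → ↥(box 4 R)) (U : GaugeConfig 4 (2 * Sq j + 1) G) =>
        ∏ i, ((r.curvature.F (Literature.MathematicalPhysics.QuantumLattice.configShift (-(↑(x i) : Site 4)) (torusLift (2 * Sq j + 1) U)) - mc : ℝ) : ℂ))
      (fun x => (hE x).1 j) w
    have h3 := csclKernel_mean_expand (wilsonMeasure (d := 4) (L := 2 * Sq j + 1) r.ρ β)
      (fun (y : Fin m → ↥(box 4 R)) (U : GaugeConfig 4 (2 * Sq j + 1) G) =>
        ∏ i, ((r.curvature.F (Literature.MathematicalPhysics.QuantumLattice.configShift (-(↑(y i) : Site 4)) (torusLift (2 * Sq j + 1) U)) - mc : ℝ) : ℂ))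
      (fun y => (hE y).1 j) w'
    beta_reduce at h1 h2 h3 ⊢
    rw [h1, h2, h3]
  have hmain := hj₀ j hj w w' σ l hσ (hT.congr key)
  exact le_of_eq_of_le (congrArg (fun z : ℂ => ‖z - l‖) (key j)) hmain

end Summit.QuantumFields.YangMills.Theorems.ContinuumLegGivenGap

end
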